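import Summits.QuantumFields.YangMills.Theorems.BalabanLadderNTMarkovMirrorDefect
import Summits.QuantumFields.YangMills.Theorems.BalabanLadderNTMarkovMirrorChiralPackage
import Summits.QuantumFields.YangMills.Theorems.BalabanLadderUVSeamRecUnitTransferPrep
import HarnessLib

/-!
# Crux `NT` (stmt-QuantumFields-19353) / `UVSeamRec.stub_floorsEngine` (stmt-QuantumFields-20043):
# the chirality-defect response is `O(a)` under the plane-resolved femto boundary law on the cube family

Ninth file of the Markov–mirror series (fleet lead prover of crux `UVSeamRec`, unit `ym-spine-20043-p1`, g6).
`defect_response_le` (`…MarkovMirrorDefect`) bounds the boundary response of the chirality defect by `N · K · 6h`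
(support-site count, increment bound, per-site one-point bound).  Here the three factors are evaluated along a unit
map `a`: `N ≤ (7M/aβ)⁴` (lattice points of the `e₀`-thickened support of `v(aβ·)`, `M ≥ 1` its radius),
`K ≤ 2·Lip(v)·aβ` (Schwartz ⇒ Lipschitz), `h = C₁ (aβ/κ)⁴` (the femto boundary law `|kerE_Q^ζ(plane_q x) − p_q β| ≤
C₁/depth⁴` at depth `≥ κ/aβ`) — so the response is `≤ C_Δ · aβ` with `C_Δ = 12·7⁴·Lip(v)·C₁·M⁴/κ⁴`
(`defect_response_le_linear`), hence `≤ √ε/2` for all large `β` (`defect_response_eventually_le`).  Consequently the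
ONE-POINT Markov–mirror package may take the plane-resolved boundary law on the cube family in place of (RBLΔ):
`lowerBounds_fst_of_mirrorPackage_fbl6`, `nt_of_markovMirror_fbl6` (`NT` BY NAME).

Inputs named, honestly: RBL+SUP, SF (engine-grade, card E), the femto boundary law for plane fields on the cubes
`Q_β` (E1-grade; implied by the tree predicate `FBL6 G r a` whenever `b_β·aβ ≤ ℓ₁`), clause (ii).
-/

set_option autoImplicit false

noncomputable section

open scoped SchwartzMap
open MeasureTheory Filter Topology
open Literature.MathematicalPhysics.QuantumFieldTheory Literature.MathematicalPhysics.QuantumLattice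
open Literature.Probability.LatticeModels
open Summit.QuantumFields.YangMills.Cruxes.OSLegsFromFemtoAndGap.DlrCollarTransfer
open Summit.QuantumFields.YangMills.Cruxes.OSLegsFromFemtoAndGap.DlrCollarTransfer.StubLower (mem_cubeSites_iff)
open Summit.QuantumFields.YangMills.Theorems.OSLegsFromFemtoAndGap (norm_smul_siteToE_sub_le)
open Summit.QuantumFields.YangMills.Cruxes.UVSeamRec.UnitTransfer
  (exists_radius norm_le_div_of_smul_siteToE mem_box_of_norm_le)
open Summit.QuantumFields.YangMills.Cruxes.NT.Reference (eventually_le_of_tendsto div_pow_depth_le)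

namespace Summit.QuantumFields.YangMills.Cruxes.NT.MarkovMirror

/-! ## §1 Increments of a Schwartz function along one lattice step; counting the thickened support -/

section Prep

/-- **Schwartz functions are Lipschitz** (compact support is not needed, but the tree's witnesses have it; we use
Mathlib's `ContDiff.lipschitzWith_of_hasCompactSupport`). [folklore] -/
theorem exists_lipschitz_bound (v : 𝓢(EuclideanSpace ℝ (Fin 4), ℝ))
    (hvK : HasCompactSupport (v : EuclideanSpace ℝ (Fin 4) → ℝ)) :
    ∃ Lv : ℝ, 0 ≤ Lv ∧ ∀ z z' : EuclideanSpace ℝ (Fin 4), |v z - v z'| ≤ Lv * ‖z - z'‖ := by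
  obtain ⟨C, hC⟩ := ContDiff.lipschitzWith_of_hasCompactSupport hvK (v.smooth 1) one_ne_zero
  refine ⟨C, C.2, fun z z' => ?_⟩
  have h := hC.dist_le_mul z z'
  rwa [Real.dist_eq, dist_eq_norm] at h

/-- One lattice step in time moves the smeared position by at most `2s` (sup-norm bookkeeping of the tree). [folklore] -/
theorem norm_smul_siteToE_add_single_sub_le {s : ℝ} (hs : 0 ≤ s) (x : Fin 4 → ℤ) :
    ‖s • siteToE (x + Pi.single 0 1) - s • siteToE x‖ ≤ 2 * s := by
  have h := norm_smul_siteToE_sub_le hs (x + Pi.single 0 1) x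
  have h1 : ‖(x + Pi.single (0 : Fin 4) (1 : ℤ)) - x‖ = 1 := by
    rw [add_sub_cancel_left, Pi.norm_single, Int.norm_eq_abs]; norm_num
  rw [h1, mul_one] at h
  exact h

/-- **Counting the thickened lattice support.**  If `v z ≠ 0` forces `‖z‖ ≤ M`, then at spacing `s > 0` every site
`x` with `v(s·x) ≠ 0` or `v(s·(x + e₀)) ≠ 0` lies in the box of radius `⌈M/s⌉₊ + 1`. [folklore] -/
theorem mem_box_of_thickSupport {v : EuclideanSpace ℝ (Fin 4) → ℝ} {M s : ℝ} (hs : 0 < s)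
    (hM : ∀ z, v z ≠ 0 → ‖z‖ ≤ M) (x : Fin 4 → ℤ)
    (hx : v (s • siteToE x) ≠ 0 ∨ v (s • siteToE (x + Pi.single 0 1)) ≠ 0) :
    x ∈ box 4 (⌈M / s⌉₊ + 1) := by
  refine mem_box_of_norm_le x ?_
  have hceil : M / s ≤ (⌈M / s⌉₊ : ℝ) := Nat.le_ceil _
  rcases hx with h | h
  · have := norm_le_div_of_smul_siteToE hs x (hM _ h)
    push_cast; linarith
  · have h1 := norm_le_div_of_smul_siteToE hs (x + Pi.single 0 1) (hM _ h)
    have h2 : ‖x‖ ≤ ‖x + Pi.single (0 : Fin 4) (1 : ℤ)‖ + 1 := by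
      have := norm_sub_le (x + Pi.single (0 : Fin 4) (1 : ℤ)) (Pi.single (0 : Fin 4) (1 : ℤ))
      rw [add_sub_cancel_right, Pi.norm_single, Int.norm_eq_abs] at this
      simpa using this
    push_cast; linarith

end Prep

/-! ## §2 The defect response is linear in the spacing -/

section Linear

variable (G : Type) [Group G] [TopologicalSpace G] [IsTopologicalGroup G] [CompactSpace G]
  [MeasurableSpace G] [BorelSpace G] (r : LatticeRep G)

/-- **The chirality-defect response is `O(s)` under the femto boundary law on the cube.**  At spacing `0 < s ≤ M`:
a cube `Q = (c, b)`; a test function `v` with `v z ≠ 0 → ‖z‖ ≤ M` (`M ≥ 1`) and increments bounded through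
`Lv`; lattice support of `v(s·)` in `Q` at depth `≥ 2`, and the `e₀`-thickened support in `Q` at depth `≥ κ/s`;
per-site one-point law `|kerE_Q^ζ(plane_q x) − p_q| ≤ C₁/depth(x)⁴` for electric `q` on the thickened support.  Then
`|kerE_Q^ζ(Wᴿ) − kerE_Q^ζ(Ṽ) − p'| ≤ (12 · 7⁴ · Lv · C₁ · M⁴ / κ⁴) · s` with the reference value `p'` of
`defect_response_le`. [folklore] -/
theorem defect_response_le_linear (β : ℝ) (c : Fin 4 → ℤ) (b : ℕ) {s M κ C₁ Lv : ℝ} (hs : 0 < s) (hsM : s ≤ M)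
    (hM1 : 1 ≤ M) (hκ : 0 < κ) (hC₁ : 0 ≤ C₁) (hLv : 0 ≤ Lv) (v : 𝓢(EuclideanSpace ℝ (Fin 4), ℝ))
    (hvM : ∀ z, v z ≠ 0 → ‖z‖ ≤ M)
    (hvL : ∀ z z' : EuclideanSpace ℝ (Fin 4), |v z - v z'| ≤ Lv * ‖z - z'‖)
    (hsupp : ∀ x : Fin 4 → ℤ, v (s • siteToE x) ≠ 0 → x ∈ cubeSites c b ∧ 2 ≤ depth c b x)
    (hthick : ∀ x : Fin 4 → ℤ, (v (s • siteToE x) ≠ 0 ∨ v (s • siteToE (x + Pi.single 0 1)) ≠ 0) →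
      x ∈ cubeSites c b ∧ κ / s ≤ (depth c b x : ℝ))
    (ζ : LGConfig 4 G) (pq : {q : Fin 4 × Fin 4 // q.1 < q.2} → ℝ)
    (hBL : ∀ q : {q : Fin 4 × Fin 4 // q.1 < q.2}, q.1.1 = 0 → ∀ x ∈ cubeSites c b,
      (v (s • siteToE x) ≠ 0 ∨ v (s • siteToE (x + Pi.single 0 1)) ≠ 0) →
        |kerE G r β c b ζ (plane G r q.1 x) - pq q| ≤ C₁ / (depth c b x : ℝ) ^ 4) :
    |kerE G r β c b ζ (fun V => ∑ x ∈ cubeSites c b, v (s • siteToE x) *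
          ∑ q : {q : Fin 4 × Fin 4 // q.1 < q.2}, plane G r q.1 (if q.1.1 = 0 then x - Pi.single 0 1 else x) V) -
        kerE G r β c b ζ (fun V => ∑ y ∈ cubeSites c b, v (s • siteToE y) * dens G r y V) -
        ∑ x ∈ cubeSites c b, (v (s • siteToE (x + Pi.single 0 1)) - v (s • siteToE x)) *
          ∑ q : {q : Fin 4 × Fin 4 // q.1 < q.2}, (if q.1.1 = 0 then pq q else 0)| ≤
      (12 * 7 ^ 4 * Lv * C₁ * M ^ 4 / κ ^ 4) * s := by
  classical
  -- the three factors
  have hK : ∀ x : Fin 4 → ℤ, |v (s • siteToE (x + Pi.single 0 1)) - v (s • siteToE x)| ≤ Lv * (2 * s) :=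
    fun x => (hvL _ _).trans (mul_le_mul_of_nonneg_left (norm_smul_siteToE_add_single_sub_le hs.le x) hLv)
  have hh : ∀ q : {q : Fin 4 × Fin 4 // q.1 < q.2}, q.1.1 = 0 → ∀ x ∈ cubeSites c b,
      (v (s • siteToE x) ≠ 0 ∨ v (s • siteToE (x + Pi.single 0 1)) ≠ 0) →
        |kerE G r β c b ζ (plane G r q.1 x) - pq q| ≤ C₁ * (s / κ) ^ 4 := fun q hq x hx hv =>
    (hBL q hq x hx hv).trans (div_pow_depth_le hC₁ hκ hs (hthick x hv).2)
  set N : ℕ := ⌈M / s⌉₊ + 1 with hN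
  have hcount : ((cubeSites c b).filter fun x =>
      v (s • siteToE x) ≠ 0 ∨ v (s • siteToE (x + Pi.single 0 1)) ≠ 0).card ≤ (2 * N + 1) ^ 4 := by
    rw [← card_box 4 N]
    refine Finset.card_le_card fun x hx => ?_
    exact mem_box_of_thickSupport hs hvM x (Finset.mem_filter.1 hx).2
  have hmain := defect_response_le G r β c b s v hsupp ζ pq (h := C₁ * (s / κ) ^ 4) (K := Lv * (2 * s))
    (by positivity) (by positivity) hh hK ((2 * N + 1) ^ 4) hcount
  refine hmain.trans ?_
  -- arithmetic: `(2N+1)⁴ · 2Lv s · 6 C₁ (s/κ)⁴ ≤ 12·7⁴ Lv C₁ M⁴/κ⁴ · s` using `2N + 1 ≤ 7M/s`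
  have hNle : ((2 * N + 1 : ℕ) : ℝ) ≤ 7 * M / s := by
    have hceil : (⌈M / s⌉₊ : ℝ) < M / s + 1 := Nat.ceil_lt_add_one (by positivity)
    have h1 : ((2 * N + 1 : ℕ) : ℝ) = 2 * (⌈M / s⌉₊ : ℝ) + 3 := by rw [hN]; push_cast; ring
    rw [h1, le_div_iff₀ hs]
    have hMs : M / s * s = M := div_mul_cancel₀ M hs.ne'
    nlinarith [hsM, hceil, hMs, hs]
  have hpow : (((2 * N + 1) ^ 4 : ℕ) : ℝ) ≤ (7 * M / s) ^ 4 := by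
    push_cast
    have h0 : (0 : ℝ) ≤ ((2 * N + 1 : ℕ) : ℝ) := by positivity
    have := pow_le_pow_left₀ h0 hNle 4
    push_cast at this
    exact this
  have hrhs : (7 * M / s) ^ 4 * (Lv * (2 * s) * (6 * (C₁ * (s / κ) ^ 4))) =
      (12 * 7 ^ 4 * Lv * C₁ * M ^ 4 / κ ^ 4) * s := by
    field_simp
    ring
  calc (((2 * N + 1) ^ 4 : ℕ) : ℝ) * (Lv * (2 * s) * (6 * (C₁ * (s / κ) ^ 4)))
      ≤ (7 * M / s) ^ 4 * (Lv * (2 * s) * (6 * (C₁ * (s / κ) ^ 4))) :=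
        mul_le_mul_of_nonneg_right hpow (by positivity)
    _ = (12 * 7 ^ 4 * Lv * C₁ * M ^ 4 / κ ^ 4) * s := hrhs

end Linear

/-! ## §3 Eventual smallness along a unit map, and the package with the boundary law in place of (RBLΔ) -/

section Eventually

variable (G : Type) [Group G] [TopologicalSpace G] [IsTopologicalGroup G] [CompactSpace G]
  [MeasurableSpace G] [BorelSpace G] (r : LatticeRep G)

/-- **(RBLΔ) from the femto boundary law on the cube family.**  Along a unit map `a → 0⁺`, for ONE compactly
supported test function `v`, cubes `Q_β` carrying the lattice support of `v(aβ·)` at depth `≥ 2` and its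
`e₀`-thickening at depth `≥ κ/aβ`, and the per-site one-point law `|kerE_{Q_β}^ζ(plane_q x) − p_q β| ≤ C₁/depth⁴`
(electric `q`, thickened support): for every `η > 0`, eventually in `β`, for every exterior `ζ`,
`|kerE_{Q_β}^ζ(Wᴿ) − kerE_{Q_β}^ζ(Ṽ) − p' β| ≤ η`. [folklore] -/
theorem defect_response_eventually_le (a : ℝ → ℝ) (ha₀ : ∀ β, 0 < a β) (ha : Tendsto a atTop (𝓝 0))
    (v : 𝓢(EuclideanSpace ℝ (Fin 4), ℝ)) (hvK : HasCompactSupport (v : EuclideanSpace ℝ (Fin 4) → ℝ))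
    {κ C₁ : ℝ} (hκ : 0 < κ) (hC₁ : 0 ≤ C₁) {β₅ : ℝ} (c : ℝ → (Fin 4 → ℤ)) (b : ℝ → ℕ)
    (p6 : ℝ → {q : Fin 4 × Fin 4 // q.1 < q.2} → ℝ)
    (hsupp : ∀ β, β₅ ≤ β → ∀ x : Fin 4 → ℤ, v (a β • siteToE x) ≠ 0 →
      x ∈ cubeSites (c β) (b β) ∧ 2 ≤ depth (c β) (b β) x)
    (hthick : ∀ β, β₅ ≤ β → ∀ x : Fin 4 → ℤ,
      (v (a β • siteToE x) ≠ 0 ∨ v (a β • siteToE (x + Pi.single 0 1)) ≠ 0) →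
        x ∈ cubeSites (c β) (b β) ∧ κ / a β ≤ (depth (c β) (b β) x : ℝ))
    (hBL : ∀ β, β₅ ≤ β → ∀ (ζ : LGConfig 4 G) (q : {q : Fin 4 × Fin 4 // q.1 < q.2}), q.1.1 = 0 →
      ∀ x ∈ cubeSites (c β) (b β),
        (v (a β • siteToE x) ≠ 0 ∨ v (a β • siteToE (x + Pi.single 0 1)) ≠ 0) →
          |kerE G r β (c β) (b β) ζ (plane G r q.1 x) - p6 β q| ≤ C₁ / (depth (c β) (b β) x : ℝ) ^ 4)
    {η : ℝ} (hη : 0 < η) :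
    ∃ β₆ : ℝ, ∀ β, β₆ ≤ β → ∀ ζ : LGConfig 4 G,
      |kerE G r β (c β) (b β) ζ (fun V => ∑ x ∈ cubeSites (c β) (b β), v (a β • siteToE x) *
            ∑ q : {q : Fin 4 × Fin 4 // q.1 < q.2}, plane G r q.1 (if q.1.1 = 0 then x - Pi.single 0 1 else x) V) -
          kerE G r β (c β) (b β) ζ (fun V => ∑ y ∈ cubeSites (c β) (b β), v (a β • siteToE y) * dens G r y V) -
          ∑ x ∈ cubeSites (c β) (b β), (v (a β • siteToE (x + Pi.single 0 1)) - v (a β • siteToE x)) *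
            ∑ q : {q : Fin 4 × Fin 4 // q.1 < q.2}, (if q.1.1 = 0 then p6 β q else 0)| ≤ η := by
  obtain ⟨M, hM1, hvM⟩ := exists_radius hvK
  obtain ⟨Lv, hLv, hvL⟩ := exists_lipschitz_bound v hvK
  set CΔ : ℝ := 12 * 7 ^ 4 * Lv * C₁ * M ^ 4 / κ ^ 4 with hCΔ
  have hCΔ0 : 0 ≤ CΔ := by positivity
  have hδ : 0 < min M (η / (CΔ + 1)) := lt_min (by linarith) (by positivity)
  obtain ⟨βa, hβa⟩ := eventually_le_of_tendsto ha hδ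
  refine ⟨max β₅ βa, fun β hβ ζ => ?_⟩
  have hβ₅ : β₅ ≤ β := le_trans (le_max_left _ _) hβ
  have hβa' : βa ≤ β := le_trans (le_max_right _ _) hβ
  have hα : 0 < a β := ha₀ β
  have hsm := hβa β hβa'
  have hsM : a β ≤ M := hsm.trans (min_le_left _ _)
  have hsη : a β ≤ η / (CΔ + 1) := hsm.trans (min_le_right _ _)
  have hlin := defect_response_le_linear G r β (c β) (b β) hα hsM hM1 hκ hC₁ hLv v hvM hvL (hsupp β hβ₅)
    (hthick β hβ₅) ζ (p6 β) (hBL β hβ₅ ζ)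
  refine hlin.trans ?_
  rw [← hCΔ]
  calc CΔ * a β ≤ CΔ * (η / (CΔ + 1)) := mul_le_mul_of_nonneg_left hsη hCΔ0
    _ ≤ η := by
        rw [mul_div_assoc']
        exact (div_le_iff₀ (by positivity)).2 (by nlinarith)

/-- **Clause (i) of `LowerBounds G r a` from the one-point package with the femto boundary law in place of (RBLΔ).**
Inputs (for one compactly supported positive-time test function `v`, cubes `Q_β` at times `≥ 1` of physical size
`≤ Λ₅`, support of `v(aβ·)` at depth `≥ 2`, thickened support at physical depth `≥ κ`): (RBL+SUP) for `Ṽ_v`, (SF) for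
`𝒢_β`, and the per-site plane-resolved boundary law `|kerE_{Q_β}^ζ(plane_q x) − p_q β| ≤ C₁/depth⁴` on the thickened
support (implied by `FBL6 G r a` on femto cubes).  Output: `ε ≤ Q2_{β,L,aβ}(θv, v)` on every torus `aβ·L ≥ Λ₅`, all
large `β`. [folklore] -/
theorem lowerBounds_fst_of_mirrorPackage_fbl6 (a : ℝ → ℝ) (ha₀ : ∀ β, 0 < a β) (ha : Tendsto a atTop (𝓝 0))
    (v : 𝓢(EuclideanSpace ℝ (Fin 4), ℝ)) (hvK : HasCompactSupport (v : EuclideanSpace ℝ (Fin 4) → ℝ))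
    (hv : tsupport (v : EuclideanSpace ℝ (Fin 4) → ℝ) ⊆ {y | 0 < y 0})
    {ε : ℝ} (hε : 0 < ε) {β₅ Λ₅ κ C₁ : ℝ} (hκ : 0 < κ) (hC₁ : 0 ≤ C₁)
    (c : ℝ → (Fin 4 → ℤ)) (b : ℝ → ℕ) (p : ℝ → ℝ) (p6 : ℝ → {q : Fin 4 × Fin 4 // q.1 < q.2} → ℝ)
    (𝒢 : ℝ → LGConfig 4 G → ℝ)
    (hgeom : ∀ β, β₅ ≤ β → 1 ≤ c β 0 ∧ ∀ j : Fin 4, (|((c β j : ℤ) : ℝ)| + (b β : ℝ) + 3) * a β ≤ Λ₅)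
    (hsupp : ∀ β, β₅ ≤ β → ∀ x : Fin 4 → ℤ, v (a β • siteToE x) ≠ 0 →
      x ∈ cubeSites (c β) (b β) ∧ 2 ≤ depth (c β) (b β) x)
    (hthick : ∀ β, β₅ ≤ β → ∀ x : Fin 4 → ℤ,
      (v (a β • siteToE x) ≠ 0 ∨ v (a β • siteToE (x + Pi.single 0 1)) ≠ 0) →
        x ∈ cubeSites (c β) (b β) ∧ κ / a β ≤ (depth (c β) (b β) x : ℝ))
    (h𝒢 : ∀ β, β₅ ≤ β → Continuous (𝒢 β) ∧ (∃ M : ℝ, ∀ U, |𝒢 β U| ≤ M) ∧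
      ∃ S : Finset (Literature.MathematicalPhysics.QuantumLattice.ZdEdge 4), IsCylinder (𝒢 β) S ∧
        ∀ e ∈ S, ∀ j, c β j - 1 ≤ e.1 j ∧ e.1 j ≤ c β j + b β + 1)
    (hRBL : ∀ β, β₅ ≤ β → ∀ ζ,
      |kerE G r β (c β) (b β) ζ (fun V => ∑ y ∈ cubeSites (c β) (b β), v (a β • siteToE y) * dens G r y V) -
        p β + 𝒢 β ζ| ≤ Real.sqrt ε / 2)
    (hBL : ∀ β, β₅ ≤ β → ∀ (ζ : LGConfig 4 G) (q : {q : Fin 4 × Fin 4 // q.1 < q.2}), q.1.1 = 0 →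
      ∀ x ∈ cubeSites (c β) (b β),
        (v (a β • siteToE x) ≠ 0 ∨ v (a β • siteToE (x + Pi.single 0 1)) ≠ 0) →
          |kerE G r β (c β) (b β) ζ (plane G r q.1 x) - p6 β q| ≤ C₁ / (depth (c β) (b β) x : ℝ) ^ 4)
    (hSF : ∀ β, β₅ ≤ β → ∀ L : ℕ, Λ₅ ≤ a β * L →
      4 * ε ≤ torusE G r β L (fun V => 𝒢 β (cfgReflect V) * 𝒢 β V) -
        torusE G r β L (fun V => 𝒢 β (cfgReflect V)) * torusE G r β L (𝒢 β)) :
    ∃ (v : 𝓢(EuclideanSpace ℝ (Fin 4), ℝ)) (ε β₅ Λ₅ : ℝ),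
      tsupport (v : EuclideanSpace ℝ (Fin 4) → ℝ) ⊆ {y : EuclideanSpace ℝ (Fin 4) | 0 < y 0} ∧ 0 < ε ∧
      ∀ β : ℝ, β₅ ≤ β → ∀ L : ℕ, Λ₅ ≤ a β * L → ε ≤ Q2 G r β L (a β) (thetaTest 4 v) v := by
  have hη : 0 < Real.sqrt ε / 2 := by positivity
  obtain ⟨β₆, hΔ⟩ := defect_response_eventually_le G r a ha₀ ha v hvK hκ hC₁ c b p6 hsupp hthick hBL hη
  -- restrict every clause to `β ≥ max β₅ β₆` and apply the chiral package
  have key := Q2_floor_of_mirrorPackage_chiral G r a ha₀ v hε (β₅ := max β₅ β₆) (Λ₅ := Λ₅) c b p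
    (fun β => ∑ x ∈ cubeSites (c β) (b β), (v (a β • siteToE (x + Pi.single 0 1)) - v (a β • siteToE x)) *
      ∑ q : {q : Fin 4 × Fin 4 // q.1 < q.2}, (if q.1.1 = 0 then p6 β q else 0)) 𝒢
    (fun β hβ => hgeom β (le_trans (le_max_left _ _) hβ))
    (fun β hβ => hsupp β (le_trans (le_max_left _ _) hβ))
    (fun β hβ => h𝒢 β (le_trans (le_max_left _ _) hβ))
    (fun β hβ => hRBL β (le_trans (le_max_left _ _) hβ))
    (fun β hβ ζ => hΔ β (le_trans (le_max_right _ _) hβ) ζ)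
    (fun β hβ => hSF β (le_trans (le_max_left _ _) hβ))
  exact ⟨v, ε, max (max β₅ β₆) 0, Λ₅, hv, hε, key⟩

/-- **`NT` BY NAME from the one-point Markov–mirror package with the femto boundary law in place of (RBLΔ)**
(plus any supplier of clause (ii)). [folklore] -/
theorem nt_of_markovMirror_fbl6
    (h : ∀ (G : Type) [Group G] [TopologicalSpace G] [IsTopologicalGroup G] [CompactSpace G],
      IsCompactSimpleLieGroup G → letI : MeasurableSpace G := borel G; haveI : BorelSpace G := ⟨rfl⟩;
      ∃ (r : LatticeRep G) (a : ℝ → ℝ), (∀ β, 0 < a β) ∧ Tendsto a atTop (𝓝 0) ∧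
        (∃ (v : 𝓢(EuclideanSpace ℝ (Fin 4), ℝ)) (ε β₅ Λ₅ κ C₁ : ℝ) (c : ℝ → (Fin 4 → ℤ)) (b : ℝ → ℕ)
          (p : ℝ → ℝ) (p6 : ℝ → {q : Fin 4 × Fin 4 // q.1 < q.2} → ℝ) (𝒢 : ℝ → LGConfig 4 G → ℝ),
          HasCompactSupport (v : EuclideanSpace ℝ (Fin 4) → ℝ) ∧
          tsupport (v : EuclideanSpace ℝ (Fin 4) → ℝ) ⊆ {y | 0 < y 0} ∧ 0 < ε ∧ 0 < κ ∧ 0 ≤ C₁ ∧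
          (∀ β, β₅ ≤ β → 1 ≤ c β 0 ∧ ∀ j : Fin 4, (|((c β j : ℤ) : ℝ)| + (b β : ℝ) + 3) * a β ≤ Λ₅) ∧
          (∀ β, β₅ ≤ β → ∀ x : Fin 4 → ℤ, v (a β • siteToE x) ≠ 0 →
            x ∈ cubeSites (c β) (b β) ∧ 2 ≤ depth (c β) (b β) x) ∧
          (∀ β, β₅ ≤ β → ∀ x : Fin 4 → ℤ,
            (v (a β • siteToE x) ≠ 0 ∨ v (a β • siteToE (x + Pi.single 0 1)) ≠ 0) →
              x ∈ cubeSites (c β) (b β) ∧ κ / a β ≤ (depth (c β) (b β) x : ℝ)) ∧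
          (∀ β, β₅ ≤ β → Continuous (𝒢 β) ∧ (∃ M : ℝ, ∀ U, |𝒢 β U| ≤ M) ∧
            ∃ S : Finset (Literature.MathematicalPhysics.QuantumLattice.ZdEdge 4), IsCylinder (𝒢 β) S ∧
              ∀ e ∈ S, ∀ j, c β j - 1 ≤ e.1 j ∧ e.1 j ≤ c β j + b β + 1) ∧
          (∀ β, β₅ ≤ β → ∀ ζ,
            |kerE G r β (c β) (b β) ζ (fun V => ∑ y ∈ cubeSites (c β) (b β), v (a β • siteToE y) * dens G r y V) -
              p β + 𝒢 β ζ| ≤ Real.sqrt ε / 2) ∧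
          (∀ β, β₅ ≤ β → ∀ (ζ : LGConfig 4 G) (q : {q : Fin 4 × Fin 4 // q.1 < q.2}), q.1.1 = 0 →
            ∀ x ∈ cubeSites (c β) (b β),
              (v (a β • siteToE x) ≠ 0 ∨ v (a β • siteToE (x + Pi.single 0 1)) ≠ 0) →
                |kerE G r β (c β) (b β) ζ (plane G r q.1 x) - p6 β q| ≤ C₁ / (depth (c β) (b β) x : ℝ) ^ 4) ∧
          (∀ β, β₅ ≤ β → ∀ L : ℕ, Λ₅ ≤ a β * L →
            4 * ε ≤ torusE G r β L (fun V => 𝒢 β (cfgReflect V) * 𝒢 β V) -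
              torusE G r β L (fun V => 𝒢 β (cfgReflect V)) * torusE G r β L (𝒢 β))) ∧
        (∃ (f g h : 𝓢(EuclideanSpace ℝ (Fin 4), ℝ)) (ε β₅ Λ₅ : ℝ), Disjoint (tsupport f) (tsupport g) ∧
          Disjoint (tsupport g) (tsupport h) ∧ Disjoint (tsupport f) (tsupport h) ∧ 0 < ε ∧
          ∀ β : ℝ, β₅ ≤ β → ∀ L : ℕ, Λ₅ ≤ a β * L → ε ≤ |Q3 G r β L (a β) f g h|)) :
    Summit.QuantumFields.YangMills.Theses.BalabanLadder.NT := by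
  intro G _ _ _ _ hG
  letI : MeasurableSpace G := borel G
  haveI : BorelSpace G := ⟨rfl⟩
  obtain ⟨r, a, ha₀, ha, ⟨v, ε, β₅, Λ₅, κ, C₁, c, b, p, p6, 𝒢, hvK, hv, hε, hκ, hC₁, hgeom, hsupp, hthick, h𝒢,
    hRBL, hBL, hSF⟩, h3⟩ := h G hG
  exact ⟨r, a, ha₀, ha, lowerBounds_fst_of_mirrorPackage_fbl6 G r a ha₀ ha v hvK hv hε hκ hC₁ c b p p6 𝒢 hgeom
    hsupp hthick h𝒢 hRBL hBL hSF, h3⟩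

end Eventually

end Summit.QuantumFields.YangMills.Cruxes.NT.MarkovMirror

end
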